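import Literature.Claims.NS.Kampen2014
import Literature.Analysis.FluidPDE.NSVorticityBKMLocalExistence
import HarnessLib

/-!
# Claim skeleton (D-0090 NS-CLAIMS, C39): Yanyou Qiao, «A solution to the incompressible Navier-Stokes
# Equation», arXiv:2102.11873 v10 (18 Oct 2022) — time power series (QUICK row)

Cell `ns-claims`, row C39 (census slug `Qiao2021`; QUICK). Typist of the CARD/PREDICTION of record:
ns-claims-typist-1 (claims/Qiao2021/CARD.md §4, 2026-08-26T23:18:24Z); skeleton typed by ns-claims-typist-12
(co-typist, lead g2 23:35:04Z). Lanes: refuter first idle (PREDICTED-R), ref-1 g2, salvage-p6, writer-1,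
lit-3. Text of record (PINNED by ns-claims-lit-3, `pub/ns-claims/sources/Qiao2022/LOCATORS.md`): arXiv
2102.11873 **v10** (18 Oct 2022, 25 pp.; page = PDF page of `arXiv-2102.11873v10-PDF+text_PINNED/`), bib
`QiaoYanyou2022`; **v11 (27 Oct 2022) is the author's WITHDRAWAL: «The convergence study of the series in
section 4 and section 5 have bugs»**; v1–v7 (2021) asserted the opposite direction and were withdrawn
(LOCATORS §3). UNREFEREED (and withdrawn) CLAIM under adjudication — NOTHING in this file asserts a step:
every `Step_k`/`Lemma_51`/`ClaimedTheorem` is a `Prop`; the `theorem`s are kernel compositions of the paper's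
own implications, the Clay link, and Abel's lemma.

## Claimed statement (as printed, v10)

Abstract p. 1: «For the N ≥ 2 dimensional incompressible Navier-Stokes Equation … We have got its solution as
v = Σ_{n=0}^∞ a_n(x) tⁿ, where a₀(x) = v⁰(x) and a_n(x) = (1/n)[νΔa_{n−1}(x) − P Σ_{i=0}^{n−1} a_i(x)·∇a_{n−1−i}(x)]
are all known functions determined only by v⁰(x). Moreover, the series Σ a_n(x)tⁿ is proved to be convergent
on (x,t) ∈ ℝ^N × [0,∞), so that the existence and smoothness problem are solved.» **Theorem 5.1 p. 22**: «The
series solution v(x,t) in Theorem 4.1 is indeed a globally smooth solution.» Setting: `ℝ^N`, `f ≡ 0`, data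
`v⁰ ∈ V^m`, `m ≥ N/2 + 2` (Thm 3.3 p. 14: «for any viscosity 0 ≤ ν < ∞ … the Euler or the Navier-Stokes
equation»); §6 p. 24: «We have solved the existence and smoothness of the Navier-Stokes equation and the
Euler equation for (x,t) ∈ ℝ^N × [0,∞), (N ≥ 2)».

RENDERING: `N = 3`; data `V^m` rendered on the `H^∞ ∩ C^∞` class `Kampen2014.IsDatum` (smooth, divergence
free, every derivative in `L²`; contains every Clay datum (4)); «globally smooth solution» = the tree's
Beale–Kato–Majda class `Kampen2014.IsGlobalSolution` (classical on `ℝ³ × [0,∞)`, all Sobolev norms bounded on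
compacts) — the C13 skeleton's vocabulary, reused rather than re-declared; the series clause = pointwise
`HasSum` in `t` for every `t ≥ 0` with `a 0 = v⁰` (the recursion for `a_n` is quoted, not typed —
TODO(general form): the Leray-projected recursion, `N ≥ 2`, data exactly `V^m`).

## Clay delta (reference `Literature.Claims.NS.ClayVariants`, axes Δ1–Δ8)

Nearest (A). Δ1 `ℝ^N ⊇ ℝ³` = · Δ2 = · Δ3 `f ≡ 0` = · Δ4 data `V^m`, `m ≥ N/2+2` ⊋ (4): STRONGER · Δ5/Δ6
global smooth (+ the series form, extra) ⊇ (6); energy (7) not printed but holds in the rendered class —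
`clay_of_claimed : ClaimedTheorem → ClayVariants.clayR3.Regularity` PROVED · Δ7 every `ν ≥ 0` (Euler too):
STRONGER. No wrong-problem axis.

## Steps — ORDERED INDEX (TYPING-HYGIENE 11; print order = dependency order)

Step 1 = `Step_33` (Thm 3.3 p. 14: local existence in `V^m`, classical — Majda–Bertozzi Ch. 3 verbatim
(CARD §5); cite) · Step 2 = `Step_41` (Thm 4.1 p. 18: «the solution … of Theorem 3.3 is indeed a series
v(x,t) = Σ a_n(x)tⁿ, (x,t) ∈ ℝ^N × [0,T]» — time-ANALYTICITY at `t = 0` with radius ≥ the existence time,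
for every datum; the author's own v11 note places «bugs» in §4; typist's flag: suspicious (for the heat part
the time-Taylor series of a non-entire datum has radius 0, of a Gaussian exactly `1/(4aν)` — tree barrier
`Literature/Barriers/NavierStokesRegularity/TimeTaylorFiniteRadius.lean`)) · Step 3 = `Lemma_51` (Lemma 5.1
p. 22: Abel's lemma — TRUE, PROVED `lemma_51_holds`) · Step 4 = `Step_5a` (proof of Thm 5.1, p. 23 first
inference: «Since v(x₀, t₀ − T/4) < ∞, −(t₀ − T/2) < t₀ − T/4, hence v(x₀, −(t₀ − T/2)) < ∞» — Lemma 5.1 is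
invoked with `τ = t₀ − T/4 > T`, i.e. FINITENESS OF THE SOLUTION at `τ` is used as CONVERGENCE OF THE SERIES
at `τ`; typed at the abstract power-series grain (HYGIENE 13, as salvage-p6 23:21:09Z asked: `(1+s)^{−3/2}`
and `1/(1+t²)` are admissible instances); typist's flag: suspicious — the located candidate) · Step 5 =
`Step_5b` (p. 23: «Replacing v⁰(x) with v(x, T/2) … ṽ(x,t) = Σ ã_n(x)tⁿ in t ∈ [0,T₀] … Noting that
ṽ(x₀, −t₀) = v(x₀, −(t₀ − T/2)) < ∞» — the restarted series evaluated at a NEGATIVE time is identified with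
the solution run backwards; abstract grain; suspicious) · Step 6 = `Step_5c` (p. 23: «Hence, by Lemma 5.1,
ṽ(x₀, t₀ − T/2) < ∞ … contradiction … This means that the Navier-Stokes Equation … has a global smooth
solution»: finiteness everywhere ⇒ the global smooth series solution — the closing inference, typed as the
implication from Steps 1–5 to the claim).

## COMPOSITION — proved as `claim_of_steps`

`claim_of_steps : Step_33 → Step_41 → Lemma_51 → Step_5a → Step_5b → Step_5c → ClaimedTheorem` — PROVED (the
closing Step 6 is the printed inference «Steps 1–5 ⇒ Thm 5.1»; pure modus ponens). NOT derivable otherwise and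
not bridged: the contradiction argument of p. 23 uses Steps 4–5 at points outside the interval where Step 2
gives the series. `clay_of_claimed` PROVED (energy (7) via the tree's `bkm_energy_le`, as in C13).

Design notes. Vocabulary imported from `Literature.Claims.NS.Kampen2014` (`IsDatum`, `IsLocalSolution`,
`IsGlobalSolution`) — same cell, same rendering conventions; nothing of C13's claim is used. No notation, no
instance. Power series are rendered by `HasSum (fun n => a n * t ^ n)` / `Summable` over `ℕ`.

WHAT THIS IS NOT: not a claim about NS regularity or blow-up; not a claim about any author beyond the
typed locator.
-/

noncomputable section

open Set Function Filter MeasureTheory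
open scoped Topology ENNReal NNReal ContDiff
open Literature.Analysis.FluidPDE
open Literature.Claims.NS.Kampen2014 (IsDatum IsLocalSolution IsGlobalSolution)

namespace Literature.Claims.NS.Qiao2021

/-- `ℝ³` (the paper's `ℝ^N`, rendered at `N = 3`). [cite: QiaoYanyou2022, §1 p. 1] -/
abbrev E3 := EuclideanSpace ℝ (Fin 3)

/-! ### The claimed statement -/

/-- The series clause of the abstract / Thm 4.1 / Thm 5.1: `u(t,x) = Σ_{n≥0} a_n(x) tⁿ` for every `t ≥ 0`
and every `x`, with `a₀ = v⁰` (the printed recursion for `a_n`, with the Leray projector `P`, is quoted in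
the module docstring and not typed). [cite: QiaoYanyou2022, abstract p. 1; Thm 4.1 p. 18; Thm 5.1 p. 22] -/
def IsTimeSeriesOn (S : Set ℝ) (v₀ : E3 → E3) (u : ℝ → E3 → E3) : Prop :=
  ∃ a : ℕ → E3 → E3, a 0 = v₀ ∧ ∀ t ∈ S, ∀ x : E3, HasSum (fun n : ℕ => (t ^ n) • a n x) (u t x)

/-- **The claimed theorem (abstract p. 1, Thm 5.1 p. 22, §6 p. 24), `N = 3`**: for every viscosity
`ν ≥ 0` («the Euler or the Navier-Stokes equation», Thm 3.3) and every datum of the class, there is a globally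
smooth solution on `ℝ³ × [0,∞)` which is, for every `t ≥ 0`, the sum of its time power series at `t = 0`
(«the series Σ a_n(x)tⁿ is proved to be convergent on (x,t) ∈ ℝ^N × [0,∞), so that the existence and
smoothness problem are solved»). [cite: QiaoYanyou2022, abstract p. 1; Thm 5.1 p. 22; §6 p. 24] -/
def ClaimedTheorem : Prop :=
  ∀ ν : ℝ, 0 ≤ ν → ∀ v₀ : E3 → E3, IsDatum v₀ →
    ∃ (u : ℝ → E3 → E3) (p : ℝ → E3 → ℝ), IsGlobalSolution ν v₀ u p ∧ IsTimeSeriesOn (Ici 0) v₀ u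

/-! ### The steps -/

/-- **Step 1 — Theorem 3.3 p. 14 (local-in-time existence in `V^m`, `m ≥ N/2 + 2`)**: «there exists a time T
with the rough upper bound T ≤ 1/(c_m ‖v⁰‖_m), such that for any viscosity 0 ≤ ν < ∞ there exists the unique
solution v^ν ∈ C([0,T]; C²(ℝ^N)) ∩ C¹([0,T]; C(ℝ^N)) to the Euler or the Navier-Stokes equation» (= Majda–
Bertozzi Thm 3.4; §§2–3 of the paper are that chapter verbatim, CARD §5). RENDERED in the BKM class.
Typist's flag: classical (cite). [cite: QiaoYanyou2022, Thm 3.3 p. 14] -/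
def Step_33 : Prop :=
  ∀ ν : ℝ, 0 ≤ ν → ∀ v₀ : E3 → E3, IsDatum v₀ →
    ∃ T : ℝ, 0 < T ∧ ∃ (u : ℝ → E3 → E3) (p : ℝ → E3 → ℝ), IsLocalSolution ν 0 T u p ∧ u 0 = v₀

/-- **Step 2 — Theorem 4.1 p. 18**: «the solution to the Navier-Stokes equation of Theorem 3.3 is indeed a
series v(x,t) = Σ_{n=0}^∞ a_n(x)tⁿ, (x,t) ∈ ℝ^N × [0,T], where a₀(x) = v⁰(x), and a_n(x) = … are all known
functions determined only by v⁰(x)» (proof pp. 18–21 via the Picard iterates of the mollified equation,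
«each v^ε_n is a polynomial of t, and hence v^ε is a power series of t and is convergent in t ∈ [0,T_ε]»,
p. 18). TYPED: every local solution of the class on `[0,T]` is the sum of a time power series on `[0,T]`.
Typist's flag: suspicious (time-analyticity AT `t = 0` with radius ≥ the existence time for every datum;
v11: «bugs» in §4; barrier `TimeTaylorFiniteRadius`). [cite: QiaoYanyou2022, Thm 4.1 p. 18, pp. 18–21] -/
def Step_41 : Prop :=
  ∀ ν : ℝ, 0 ≤ ν → ∀ T : ℝ, 0 < T → ∀ (u : ℝ → E3 → E3) (p : ℝ → E3 → ℝ),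
    IsLocalSolution ν 0 T u p → IsDatum (u 0) → IsTimeSeriesOn (Icc 0 T) (u 0) u

/-- **Step 3 — Lemma 5.1 p. 22** («a special property of power series»): «if Σ a_n tⁿ is a series, τ is a
constant, τ > 0 or τ < 0, and Σ a_n τⁿ is convergent, then for all |t| < |τ|, Σ a_n tⁿ is convergent»
(Abel's lemma; the printed proof bounds `|a_n τⁿ| ≤ M` and compares with a geometric series). TRUE; PROVED
(`lemma_51_holds`, absolute convergence). [cite: QiaoYanyou2022, Lemma 5.1 p. 22] -/
def Lemma_51 : Prop :=
  ∀ (a : ℕ → ℝ) (τ t : ℝ), τ ≠ 0 → Summable (fun n : ℕ => a n * τ ^ n) → |t| < |τ| →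
    Summable (fun n : ℕ => a n * t ^ n)

/-- **Step 4 — proof of Thm 5.1, p. 23, first inference**: «Assume that there is a (x₀,t₀) such that
v(x₀,t₀) = ∞ … t₀ > T, and t₀ can be chosen to be the minimal, so that … v(x₀,t) < ∞ (0 ≤ t < t₀). Since
v(x₀, (t₀ − T/4)) < ∞, −(t₀ − T/2) < t₀ − T/4, hence v(x₀, −(t₀ − T/2)) < ∞.» Lemma 5.1 is applied with
`τ = t₀ − T/4 > T`: the FINITENESS of the solution at `τ` (outside `[0,T]`, where Step 2 gives the series)
is used as CONVERGENCE OF THE SERIES at `τ`. TYPED at the abstract power-series grain (TYPING-HYGIENE 13;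
salvage-p6 23:21:09Z): a smooth function on `ℝ` that is the sum of its power series on `[0,T]` has that series
convergent at every `τ > T` (the print needs it at `τ = t₀ − T/4`, then at negative times). Typist's flag:
suspicious (`1/(1+t²)`: radius 1, smooth on `ℝ`). [cite: QiaoYanyou2022, proof of Thm 5.1 p. 23] -/
def Step_5a : Prop :=
  ∀ (a : ℕ → ℝ) (f : ℝ → ℝ) (T τ : ℝ), 0 < T → T < τ → ContDiff ℝ ∞ f →
    (∀ t ∈ Icc 0 T, HasSum (fun n : ℕ => a n * t ^ n) (f t)) →
      Summable (fun n : ℕ => a n * τ ^ n)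

/-- **Step 5 — p. 23, the time shift**: «Replacing v⁰(x) with v(x, T/2), the Navier-Stokes equation will
become (5.1)–(5.3) … have a series form solution ṽ(x,t) in t ∈ [0,T₀] … ṽ(x,t) = Σ ã_n(x)tⁿ. Noting that
ṽ(x₀, −t₀) = v(x₀, −(t₀ − T/2)) < ∞» — the restarted series, EVALUATED AT A NEGATIVE TIME, is identified
with the solution run backwards (`ṽ(·,s) = v(·, s + T/2)` for `s < 0`). TYPED at the abstract grain: if a
smooth `f` is the sum of its power series on `[0,T₀]`, then wherever that series converges at a negative time
it sums to `f` there. Typist's flag: suspicious (a smooth function vanishing on `[0,∞)` and positive on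
`(−∞,0)` has the zero series). [cite: QiaoYanyou2022, proof of Thm 5.1 p. 23, (5.1)–(5.3)] -/
def Step_5b : Prop :=
  ∀ (a : ℕ → ℝ) (f : ℝ → ℝ) (T₀ s : ℝ), 0 < T₀ → s < 0 → ContDiff ℝ ∞ f →
    (∀ t ∈ Icc 0 T₀, HasSum (fun n : ℕ => a n * t ^ n) (f t)) →
      Summable (fun n : ℕ => a n * s ^ n) → HasSum (fun n : ℕ => a n * s ^ n) (f s)

/-- **Step 6 — p. 23, the closing inference**: «Hence, by Lemma 5.1, ṽ(x₀, t₀ − T/2) < ∞. However … ṽ(x₀,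
t₀ − T/2) = v(x₀,t₀) = ∞. Thus, a contradiction … So, there should be v(x,t) < ∞, (x,t) ∈ ℝ^N × [0,∞). This
means that the Navier-Stokes Equation … has a global smooth solution … Similarly, the Euler Equation». TYPED
as the printed implication: Steps 1–5 ⇒ the claimed theorem. Typist's flag: suspicious (finiteness of a
formal series' values is equated with a global smooth solution). [cite: QiaoYanyou2022, proof of Thm 5.1 p. 23] -/
def Step_5c : Prop :=
  Step_33 → Step_41 → Lemma_51 → Step_5a → Step_5b → ClaimedTheorem

/-! ### Kernel relations -/

/-- Lemma 5.1 holds (Abel's lemma): from `a_n τⁿ → 0` get `|a_n τⁿ| ≤ M`, then `|a_n tⁿ| ≤ M |t/τ|ⁿ` is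
dominated by a convergent geometric series. [cite: QiaoYanyou2022, Lemma 5.1 p. 22] -/
theorem lemma_51_holds : Lemma_51 := by
  intro a τ t hτ hsum ht
  have hτpos : 0 < |τ| := abs_pos.mpr hτ
  -- the terms tend to zero, hence are bounded
  have h0 : Tendsto (fun n : ℕ => a n * τ ^ n) atTop (𝓝 0) := hsum.tendsto_atTop_zero
  obtain ⟨M, hM⟩ : ∃ M : ℝ, ∀ n, |a n * τ ^ n| ≤ M := by
    have hb := h0.abs
    rw [abs_zero] at hb
    obtain ⟨N, hN⟩ := (hb.eventually (gt_mem_nhds zero_lt_one)).exists_forall_of_atTop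
    refine ⟨max 1 (Finset.sup' (Finset.range (N + 1)) ⟨0, by simp⟩ fun n => |a n * τ ^ n|), fun n => ?_⟩
    by_cases hn : n ≤ N
    · exact le_trans (Finset.le_sup' (fun n => |a n * τ ^ n|) (Finset.mem_range.mpr (Nat.lt_succ_of_le hn)))
        (le_max_right _ _)
    · exact le_trans (hN n (le_of_lt (not_le.mp hn))).le (le_max_left _ _)
  have hq : |t / τ| < 1 := by
    rw [abs_div, div_lt_one hτpos]; exact ht
  have hqnn : 0 ≤ |t / τ| := abs_nonneg _
  -- domination by the geometric series M * |t/τ|^n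
  refine Summable.of_norm_bounded (g := fun n : ℕ => M * |t / τ| ^ n)
    ((summable_geometric_of_lt_one hqnn hq).mul_left M) fun n => ?_
  rw [Real.norm_eq_abs]
  have hM0 : 0 ≤ M := le_trans (abs_nonneg _) (hM 0)
  calc |a n * t ^ n| = |a n * τ ^ n| * |t / τ| ^ n := by
        rw [← abs_pow, ← abs_mul, div_pow, mul_assoc, mul_div_cancel₀ _ (pow_ne_zero n hτ)]
    _ ≤ M * |t / τ| ^ n := mul_le_mul_of_nonneg_right (hM n) (pow_nonneg hqnn n)

/-- **KERNEL COMPOSITION** — Thm 5.1 / the abstract's claim from the Steps by the printed closing inference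
(Step 6); pure modus ponens. [cite: QiaoYanyou2022, Thm 5.1 pp. 22–23] -/
theorem claim_of_steps (h33 : Step_33) (h41 : Step_41) (h51 : Lemma_51) (h5a : Step_5a) (h5b : Step_5b)
    (h5c : Step_5c) : ClaimedTheorem :=
  h5c h33 h41 h51 h5a h5b

/-- **Clay link (TYPING-HYGIENE 10(a))**: the claimed theorem implies Clay (A) — restrict to `ν > 0` and
Schwartz data; the energy bound (7) holds in the rendered class by the tree's energy inequality
`IsClassicalNSSolutionOn.bkm_energy_le` (same argument as `Kampen2014.clay_of_claimed`). PROVED.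
[cite: QiaoYanyou2022, abstract p. 1; §6 p. 24] -/
theorem clay_of_claimed (hC : ClaimedTheorem) : ClayVariants.clayR3.Regularity := by
  intro ν hν u₀ hu₀ hdiv hdecay
  have hdat : IsDatum u₀ :=
    ⟨hu₀, fun x => hdiv x, fun n => hdecay.lintegral_enorm_iteratedFDeriv_sq_lt_top n⟩
  obtain ⟨u, p, hsol, -⟩ := hC ν hν.le u₀ hdat
  obtain ⟨hns, hsu, hsp⟩ :=
    (isNavierStokesSolution_and_smooth_iff (ν := ν) (f := 0) (u₀ := u₀) (u := u) (p := p)).2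
      ⟨hsol.isClassical, hsol.initial⟩
  refine ⟨u, p, hsu, hsp, hns, ?_⟩
  show HasBoundedEnergy u
  have key : ∀ S : ℝ, 0 < S → ∀ τ ∈ Icc (0:ℝ) S,
      ∫⁻ x, ‖u τ x‖ₑ ^ 2 = ENNReal.ofReal (∫ x, ‖u τ x‖ ^ 2) := by
    intro S hS τ hτ
    have hcl : IsClassicalNSSolutionOn (Icc 0 S) ν 0 u p :=
      hsol.isClassical.mono Icc_subset_Ici_self (uniqueDiffOn_Icc hS)
    obtain ⟨C, hC⟩ := hsol.sobolev S 0
    have hfin0 : ∫⁻ x, ‖iteratedFDeriv ℝ 0 (u τ) x‖ₑ ^ 2 < ⊤ := (hC τ hτ).trans_lt ENNReal.coe_lt_top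
    have heq : (fun x => ‖iteratedFDeriv ℝ 0 (u τ) x‖ₑ ^ 2) = fun x => ‖u τ x‖ₑ ^ 2 := by
      funext x
      rw [← ofReal_norm, norm_iteratedFDeriv_zero, ofReal_norm]
    have hfin : ∫⁻ x, ‖u τ x‖ₑ ^ 2 < ⊤ := by rwa [heq] at hfin0
    have hint : Integrable (fun x => ‖u τ x‖ ^ 2) :=
      integrable_sq_norm_of_lintegral_lt_top (hcl.contDiff_velocity hτ).continuous hfin
    rw [ofReal_integral_eq_lintegral_ofReal hint (Eventually.of_forall fun x => sq_nonneg _)]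
    refine lintegral_congr fun x => ?_
    rw [← ofReal_norm, ENNReal.ofReal_pow (norm_nonneg _)]
  refine ⟨∫⁻ x, ‖u₀ x‖ₑ ^ 2, ?_, fun t ht => ?_⟩
  · have h0 := hdat.2.2 0
    have heq : (fun x => ‖iteratedFDeriv ℝ 0 u₀ x‖ₑ ^ 2) = fun x => ‖u₀ x‖ₑ ^ 2 := by
      funext x
      rw [← ofReal_norm, norm_iteratedFDeriv_zero, ofReal_norm]
    rwa [heq] at h0
  · have hT : (0:ℝ) < t + 1 := by linarith
    have hcl : IsClassicalNSSolutionOn (Icc 0 (t + 1)) ν 0 u p :=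
      hsol.isClassical.mono Icc_subset_Ici_self (uniqueDiffOn_Icc hT)
    have hE : ∫ x, ‖u t x‖ ^ 2 ≤ ∫ x, ‖u 0 x‖ ^ 2 :=
      hcl.bkm_energy_le hν.le hT (hsol.sobolev (t + 1)) ⟨ht, by linarith⟩
    rw [key (t + 1) hT t ⟨ht, by linarith⟩, ← hsol.initial, key (t + 1) hT 0 ⟨le_rfl, hT.le⟩]
    exact ENNReal.ofReal_le_ofReal hE

/-! ### `Step_33` discharged (APPEND-ONLY, cell `ns-claims` typist-12 g5, 2026-08-27; pointer typist-11 g5)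

Theorem 3.3 p. 14 is Majda–Bertozzi 2002 Thm 3.4 (local existence in `H^m`, `ν ≥ 0`), which the tree holds as
the discharged fact `Literature.Analysis.FluidPDE.MajdaBertozzi2002_localExistenceH3_holds`
(`NSVorticityBKMLocalExistence.lean`): for `ν ≥ 0` and every bound `A` on the squared `H³` size of the datum there
is `τ > 0` such that every smooth divergence-free `H^∞` datum of that size launches a classical unforced
solution on `[0, τ] × ℝ³` with all Sobolev norms bounded — i.e. exactly `IsLocalSolution ν 0 τ u p ∧ u 0 = v₀`. -/

/-- **`Step_33` HOLDS** (Thm 3.3 p. 14 = Majda–Bertozzi Thm 3.4, `N = 3`, rendered in the BKM class): apply the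
tree's local existence theorem with `A :=` the datum's own `Σ_{n ≤ 3} ∫‖Dⁿv₀‖²` (finite for `IsDatum v₀`).
[cite: QiaoYanyou2022, Thm 3.3 p. 14] [cite: MajdaBertozzi2002, Thm. 3.4 (i)-(ii) (p. 104), Cor. 3.2 (p. 112), remark p. 117] -/
theorem step_33_holds : Step_33 := by
  intro ν hν v₀ hv₀
  obtain ⟨hsm, hdiv, hfin⟩ := hv₀
  -- the datum's squared `H³` size, a finite `ℝ≥0∞` number, as the bound `A`
  set S : ℝ≥0∞ := ∑ n ∈ Finset.range 4, ∫⁻ x, ‖iteratedFDeriv ℝ n v₀ x‖ₑ ^ 2 with hS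
  have hSfin : S ≠ ⊤ := by
    rw [hS]
    exact ENNReal.sum_ne_top.2 fun n _ => (hfin n).ne
  obtain ⟨τ, hτ, hloc⟩ := MajdaBertozzi2002_localExistenceH3_holds hν S.toNNReal
  obtain ⟨u, p, hcl, hu0, hsob⟩ :=
    hloc hsm hdiv hfin (by rw [ENNReal.coe_toNNReal hSfin])
  exact ⟨τ, hτ, u, p, ⟨hcl, hsob⟩, hu0⟩

end Literature.Claims.NS.Qiao2021

end
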